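/-
Copyright (c) 2026 the pub-hodgecm-mathlib formalisation cell (harness21).  Prover seat hodgecm-mathlib-K2E3-p21 (g5), Track B «K2-LIT» ∕ h413
(`stmt-HodgeConjecture-24833`), line `K2_E3_EllipticInputs`, unit U12 §L, road «GL-[M6]-sc» (line lead K2E3-p23 (g5), RULINGS #5 (M5-4) ∕ #7 (M7-1) ∕ #8 (M8-2)),
brick B4-J, FILE 2 of 3: «THE UNIPOTENT RADICALS `U_c ≤ GL_n(F)` AND THEIR IMAGES `N̄_c ≤ GL_n(F) ⧸ Λ·1` ARE INCREASING UNIONS OF COMPACT OPEN SUBGROUPS; THEIR HAAR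
MEASURES ARE TWO-SIDED; FUNCTIONS COMPACTLY SUPPORTED MODULO THE CENTRE ARE COMPACTLY SUPPORTED ALONG `U`».  2026-09-04.
-/
import Summits.HodgeConjecture.HodgeConjecture.Theorems.K2E3GLnUnipotentModScalars     -- ★ FILE 1 (this seat): `U ≃ₜ* N̄`, `isClosed_coe_map_mk'`, `isCompact_preimage_coe_mul_map_scalar`
import Literature.MeasureTheory.Group.HaarUnionCompactSubgroups                          -- ★ `isMulRightInvariant_of_forall_mem_isCompact_subgroup`, `isInvInvariant_of_forall_mem_isCompact_subgroup`
import Literature.NumberTheory.Weil1964.GLnRestrictedProductHaar                         -- ★ `secondCountableTopology_generalLinearGroup`; brings ★ `locallyCompactSpace_generalLinearGroup` (`GLnGelfandKazhdanInvolution`)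
import HarnessLib

/-!
# K2_E3 road (h413), road «GL-[M6]-sc», brick B4-J (file 2): the sequence currency `N_j` for `U_c(F)` and `N̄_c = π_Λ(U_c)`, two-sidedness of their Haar
# measures, and compact support along `U` of functions compactly supported modulo the centre of `GL_n(F)`

Cell `pub/hodgecm-mathlib` (D-0151), Track B, seat K2E3-p21 (g5); line lead K2E3-p23 (g5) (RULINGS #8 (M8-2)), dealer K2E3-plan (g3).  `--supports stmt-HodgeConjecture-24833
--as helper`; THEOREMS ONLY (no definition ∕ instance ∕ notation ∕ named-fact hypothesis ∕ `sorry`).  NOTATION as in ★ FILE 1 `K2E3GLnUnipotentModScalars` (spelled out):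
`Λ·1 := Λ₀.map (GL.scalar (Fin n))`, `G_Λ := GL (Fin n) F ⧸ Λ·1`, `π_Λ = QuotientGroup.mk' (Λ·1)`, `U_c = unipotentRadicalGL F c` (`c` monotone), `N̄_c := U_c.map π_Λ`.

THE MATHEMATICS (folklore; [BernsteinZelevinsky1976, §1.7: the unipotent radical is the union of its compact open subgroups]; [Casselman1995, Prop. 1.4.4];
[Folland1995, §2.4 Prop. 2.27, Cor. 2.28: such groups are unimodular]; [HarishChandra1970, Part I §3 p. 9: compact support modulo the centre]).
* §1 `exists_compactOpen_subgroups_of_isLimitOfCompactOpen` — a σ-compact group that is a limit of compact open subgroups (★ `IsLimitOfCompactOpen`, the compact-set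
  currency) is an INCREASING UNION `⋃_j N_j` of compact open subgroups (the sequence currency of ★ `K2E1SupercuspidalCoefficientNCuspidal`): `N_{j+1} ⊇ K_{j+1} ∪ N_j`
  along a compact exhaustion `K_j`; `exists_compactOpen_subgroups_of_continuousMulEquiv` (transport along `≃ₜ*`).
* §2 `GL_n(F)`, `F` a non-archimedean local field (★ `secondCountableTopology_generalLinearGroup`, ★ `locallyCompactSpace_generalLinearGroup`):
  **`exists_compactOpen_subgroups_unipotentRadicalGL`** (★ `isLimitOfCompactOpen_unipotentRadicalGL` in the sequence currency) and, along ★ FILE 1's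
  `U_c ≃ₜ* N̄_c`, **`exists_compactOpen_subgroups_map_unipotentRadicalGL`**.
* §3 every Haar measure on `↥U_c` and on `↥N̄_c` is RIGHT-invariant and INVERSION-invariant (★ `isMulRightInvariant_of_forall_mem_isCompact_subgroup` ∕
  `isInvInvariant_of_forall_mem_isCompact_subgroup`: every element lies in a compact subgroup) — so the right-invariant-measure heads of ★
  `K2E1SupercuspidalCoefficientNCuspidal` apply to ANY Haar measure: `isMulRightInvariant_haar_unipotentRadicalGL`, `isInvInvariant_haar_unipotentRadicalGL`,
  `isMulRightInvariant_haar_map_unipotentRadicalGL`, `isInvInvariant_haar_map_unipotentRadicalGL` (+ the frame facts `locallyCompactSpace_∕secondCountableTopology_∕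
  t2Space_map_unipotentRadicalGL`).
* §4 **`isCompact_preimage_coe_mul_center`** (`{u ∈ U | u ∈ C · Z(GL_n(F))}` is compact for `C` compact: ★ FILE 1 at `Λ₀ = ⊤`, `Z(GL_n) = F^×·1`) and
  **`hasCompactSupport_comp_translate_of_support_subset_mul_center`**: if `supp θ ⊆ C · Z(GL_n(F))` with `C` compact (e.g. a smooth coefficient of a SUPERCUSPIDAL
  representation of `GL_n(F)`, ★ `Representation.IsSupercuspidal`), then for all `x, y` the function `u ↦ θ(x u y)` on `↥U` has COMPACT SUPPORT — the
  convergence input of the `GL_n(F)`-level cusp-form heads of FILE 3 (at `GL_n(F)` the centre is NOT compact, so ★ `hasCompactSupport_matrixCoeff` does not apply;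
  this lemma replaces it along unipotent subgroups).

HONEST LABEL: HC_CM is proved only modulo the 7 printed citations (2 remaining named inputs: hLiu418 = `stmt-HodgeConjecture-24832`, h413 = `stmt-HodgeConjecture-24833`)
until rung 0 closes; this file is a count-neutral helper and closes no socket.

## References
* [BernsteinZelevinsky1976] I. N. Bernstein, A. V. Zelevinsky, *Representations of the group GL(n, F) where F is a non-archimedean local field*, Russian Math.
  Surveys 31:3 (1976), §1.7, Prop. 2.35.
* [Casselman1995] W. Casselman, *Introduction to the theory of admissible representations of `p`-adic reductive groups* (1995 notes), Prop. 1.4.4, Thm. 5.3.1.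
* [Folland1995] G. B. Folland, *A Course in Abstract Harmonic Analysis* (1995), §2.4 Prop. 2.27, Cor. 2.28.
* [HarishChandra1970] Harish-Chandra (notes by G. van Dijk), *Harmonic Analysis on Reductive p-adic Groups*, LNM 162 (1970), Part I §3 p. 9, Part VII §3 p. 70.
-/

set_option autoImplicit false
-- the mandated namespace repeats the single-problem summit's segment (`HodgeConjecture.HodgeConjecture`)
set_option linter.dupNamespace false

noncomputable section

open Set Filter Topology MeasureTheory
open scoped MatrixGroups Pointwise
open Literature.NumberTheory.Automorphic Literature.NumberTheory.GaloisRepresentations Literature.NumberTheory.GaloisRepresentations.IsNonarchimedeanLocalField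
open Summit.HodgeConjecture.HodgeConjecture.Cruxes.H413.K2E3GLnUnipotentModScalars

namespace Summit.HodgeConjecture.HodgeConjecture.Cruxes.H413.K2E3GLnUnipotentExhaustion

/-! ## §1  Generic: the sequence currency from the compact-set currency -/

section Generic

/-- **A σ-compact group that is a limit of compact open subgroups (★ `IsLimitOfCompactOpen`) is an INCREASING UNION of compact open subgroups** — the
sequence currency `N_j` of ★ `K2E1SupercuspidalCoefficientNCuspidal` from the compact-set currency: take `N_{j+1} ⊇ K_{j+1} ∪ N_j` along a compact exhaustion `K_j`.
[cite: BernsteinZelevinsky1976, §1.7] [cite: Casselman1995, Prop. 1.4.4] -/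
theorem exists_compactOpen_subgroups_of_isLimitOfCompactOpen {H : Type*} [Group H] [TopologicalSpace H] [SigmaCompactSpace H]
    (h : IsLimitOfCompactOpen H) :
    ∃ Nj : ℕ → Subgroup H, Monotone Nj ∧ (∀ j, IsCompact (Nj j : Set H)) ∧ (∀ j, IsOpen (Nj j : Set H)) ∧ ∀ x : H, ∃ j, x ∈ Nj j := by
  have step : ∀ (K : {K : Subgroup H // IsCompact (K : Set H) ∧ IsOpen (K : Set H)}) (j : ℕ),
      ∃ K' : {K : Subgroup H // IsCompact (K : Set H) ∧ IsOpen (K : Set H)}, compactCovering H j ⊆ (K'.1 : Set H) ∧ (K.1 : Set H) ⊆ K'.1 := by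
    intro K j
    obtain ⟨K', hK'o, hK'c, hsub⟩ := h (compactCovering H j ∪ (K.1 : Set H)) ((isCompact_compactCovering H j).union K.2.1)
    exact ⟨⟨K', hK'c, hK'o⟩, Set.subset_union_left.trans hsub, Set.subset_union_right.trans hsub⟩
  choose next hnext₁ hnext₂ using step
  obtain ⟨K₀, hK₀o, hK₀c, -⟩ := h ∅ isCompact_empty
  let T : ℕ → {K : Subgroup H // IsCompact (K : Set H) ∧ IsOpen (K : Set H)} := fun j =>
    Nat.rec (next ⟨K₀, hK₀c, hK₀o⟩ 0) (fun j K => next K (j + 1)) j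
  have hT0 : T 0 = next ⟨K₀, hK₀c, hK₀o⟩ 0 := rfl
  have hTs : ∀ j, T (j + 1) = next (T j) (j + 1) := fun j => rfl
  refine ⟨fun j => (T j).1, ?_, fun j => (T j).2.1, fun j => (T j).2.2, fun x => ?_⟩
  · refine monotone_nat_of_le_succ fun j => ?_
    show (T j).1 ≤ (T (j + 1)).1
    rw [hTs]
    exact SetLike.coe_subset_coe.1 (hnext₂ (T j) (j + 1))
  · obtain ⟨j, hj⟩ := exists_mem_compactCovering x
    refine ⟨j, ?_⟩
    rcases j with _ | j
    · show x ∈ (T 0).1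
      rw [hT0]; exact hnext₁ _ 0 hj
    · show x ∈ (T (j + 1)).1
      rw [hTs]; exact hnext₁ (T j) (j + 1) hj

/-- **Transport of the sequence currency along an isomorphism of topological groups** (`N_j ↦ e(N_j)`). [folklore] -/
theorem exists_compactOpen_subgroups_of_continuousMulEquiv {A B : Type*} [Group A] [TopologicalSpace A] [Group B] [TopologicalSpace B] (e : A ≃ₜ* B)
    (h : ∃ Nj : ℕ → Subgroup A, Monotone Nj ∧ (∀ j, IsCompact (Nj j : Set A)) ∧ (∀ j, IsOpen (Nj j : Set A)) ∧ ∀ x : A, ∃ j, x ∈ Nj j) :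
    ∃ Nj : ℕ → Subgroup B, Monotone Nj ∧ (∀ j, IsCompact (Nj j : Set B)) ∧ (∀ j, IsOpen (Nj j : Set B)) ∧ ∀ y : B, ∃ j, y ∈ Nj j := by
  obtain ⟨Nj, hmono, hc, ho, hex⟩ := h
  have hcoe : ∀ j, ((Nj j).map e.toMulEquiv.toMonoidHom : Set B) = e '' (Nj j : Set A) := fun j => by
    rw [Subgroup.coe_map]; rfl
  refine ⟨fun j => (Nj j).map e.toMulEquiv.toMonoidHom, fun i j hij => Subgroup.map_mono (hmono hij), fun j => ?_, fun j => ?_, fun y => ?_⟩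
  · rw [hcoe]; exact (hc j).image e.continuous
  · rw [hcoe]; exact e.toHomeomorph.isOpenMap _ (ho j)
  · obtain ⟨j, hj⟩ := hex (e.symm y)
    exact ⟨j, Subgroup.mem_map.2 ⟨e.symm y, hj, e.apply_symm_apply y⟩⟩

/-- **Pointwise reading**: under the sequence currency every element lies in a compact subgroup (the hypothesis of ★ `isMulRightInvariant_of_forall_mem_isCompact_subgroup`).
[cite: Folland1995, §2.4 Prop. 2.27] -/
theorem forall_exists_mem_isCompact_subgroup_of_seq {H : Type*} [Group H] [TopologicalSpace H]
    (h : ∃ Nj : ℕ → Subgroup H, Monotone Nj ∧ (∀ j, IsCompact (Nj j : Set H)) ∧ (∀ j, IsOpen (Nj j : Set H)) ∧ ∀ x : H, ∃ j, x ∈ Nj j) :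
    ∀ x : H, ∃ K : Subgroup H, IsCompact (K : Set H) ∧ x ∈ K := by
  obtain ⟨Nj, -, hc, -, hex⟩ := h
  intro x
  obtain ⟨j, hj⟩ := hex x
  exact ⟨Nj j, hc j, hj⟩

end Generic

/-! ## §2  `U_c(F)` and `N̄_c = π_Λ(U_c)` are increasing unions of compact open subgroups -/

section GLn

variable {F : Type*} [Field F] [ValuativeRel F] [TopologicalSpace F] [IsNonarchimedeanLocalField F] {n : ℕ}

/-- **The unipotent radical `U_c(F)` of a standard parabolic of `GL_n(F)` (monotone block labelling `c`) is an increasing union of compact open subgroups**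
(★ `isLimitOfCompactOpen_unipotentRadicalGL` in the sequence currency; `U_c` is closed in the σ-compact `GL_n(F)`). [cite: BernsteinZelevinsky1976, §1.7] -/
theorem exists_compactOpen_subgroups_unipotentRadicalGL {α : Type*} [LinearOrder α] (c : Fin n → α) (hc : Monotone c) :
    ∃ Nj : ℕ → Subgroup ↥(unipotentRadicalGL F c), Monotone Nj ∧ (∀ j, IsCompact (Nj j : Set ↥(unipotentRadicalGL F c))) ∧
      (∀ j, IsOpen (Nj j : Set ↥(unipotentRadicalGL F c))) ∧ ∀ x, ∃ j, x ∈ Nj j := by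
  classical
  haveI : T2Space F := (isLocalField F).toT2Space
  haveI := Literature.NumberTheory.Weil1964.secondCountableTopology_generalLinearGroup F n
  haveI := locallyCompactSpace_generalLinearGroup F (n := n)
  haveI : SigmaCompactSpace ↥(unipotentRadicalGL F c) := (isClosed_unipotentRadicalGL (R := F) c).isClosedEmbedding_subtypeVal.sigmaCompactSpace
  exact exists_compactOpen_subgroups_of_isLimitOfCompactOpen (isLimitOfCompactOpen_unipotentRadicalGL F c hc)

/-- **The image `N̄_c = π_Λ(U_c)` of the unipotent radical in `G_Λ = GL_n(F) ⧸ Λ·1` is an increasing union of compact open subgroups** (transport along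
★ FILE 1 `U_c ≃ₜ* N̄_c`). [cite: BernsteinZelevinsky1976, §1.7] [cite: HarishChandra1970, Part VII §3 p. 70] -/
theorem exists_compactOpen_subgroups_map_unipotentRadicalGL [NeZero n] {r : ℕ} (c : Fin n → Fin r) (hc : Monotone c) (Λ₀ : Subgroup Fˣ)
    [(Λ₀.map (Matrix.GeneralLinearGroup.scalar (Fin n))).Normal] :
    ∃ Nj : ℕ → Subgroup ↥((unipotentRadicalGL F c).map (QuotientGroup.mk' (Λ₀.map (Matrix.GeneralLinearGroup.scalar (Fin n))))),
      Monotone Nj ∧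
      (∀ j, IsCompact (Nj j : Set ↥((unipotentRadicalGL F c).map (QuotientGroup.mk' (Λ₀.map (Matrix.GeneralLinearGroup.scalar (Fin n))))))) ∧
      (∀ j, IsOpen (Nj j : Set ↥((unipotentRadicalGL F c).map (QuotientGroup.mk' (Λ₀.map (Matrix.GeneralLinearGroup.scalar (Fin n))))))) ∧
      ∀ x, ∃ j, x ∈ Nj j := by
  obtain ⟨e, -⟩ := exists_continuousMulEquiv_map_mk' (unipotentRadicalGL_le_upperUnitriangular c hc) Λ₀
  exact exists_compactOpen_subgroups_of_continuousMulEquiv e (exists_compactOpen_subgroups_unipotentRadicalGL c hc)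

/-! ## §3  Frame facts for `↥U_c`, `↥N̄_c` and two-sidedness of their Haar measures -/

/-- `↥U_c` is locally compact (closed in `GL_n(F)`). [folklore] -/
theorem locallyCompactSpace_unipotentRadicalGL {α : Type*} [LinearOrder α] (c : Fin n → α) : LocallyCompactSpace ↥(unipotentRadicalGL F c) := by
  classical
  haveI : T2Space F := (isLocalField F).toT2Space
  haveI := locallyCompactSpace_generalLinearGroup F (n := n)
  exact (isClosed_unipotentRadicalGL (R := F) c).isClosedEmbedding_subtypeVal.locallyCompactSpace

/-- `↥U_c` is second countable. [folklore] -/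
theorem secondCountableTopology_unipotentRadicalGL {α : Type*} [LinearOrder α] (c : Fin n → α) : SecondCountableTopology ↥(unipotentRadicalGL F c) := by
  haveI := Literature.NumberTheory.Weil1964.secondCountableTopology_generalLinearGroup F n
  exact TopologicalSpace.Subtype.secondCountableTopology _

/-- `↥N̄_c` is locally compact (homeomorphic to `↥U_c`, ★ FILE 1). [folklore] -/
theorem locallyCompactSpace_map_unipotentRadicalGL [NeZero n] {r : ℕ} (c : Fin n → Fin r) (hc : Monotone c) (Λ₀ : Subgroup Fˣ)
    [(Λ₀.map (Matrix.GeneralLinearGroup.scalar (Fin n))).Normal] :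
    LocallyCompactSpace ↥((unipotentRadicalGL F c).map (QuotientGroup.mk' (Λ₀.map (Matrix.GeneralLinearGroup.scalar (Fin n))))) := by
  obtain ⟨e, -⟩ := exists_continuousMulEquiv_map_mk' (unipotentRadicalGL_le_upperUnitriangular c hc) Λ₀
  haveI := locallyCompactSpace_unipotentRadicalGL (F := F) c
  exact e.toHomeomorph.locallyCompactSpace_iff.1 inferInstance

/-- `↥N̄_c` is second countable (homeomorphic to `↥U_c`). [folklore] -/
theorem secondCountableTopology_map_unipotentRadicalGL [NeZero n] {r : ℕ} (c : Fin n → Fin r) (hc : Monotone c) (Λ₀ : Subgroup Fˣ)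
    [(Λ₀.map (Matrix.GeneralLinearGroup.scalar (Fin n))).Normal] :
    SecondCountableTopology ↥((unipotentRadicalGL F c).map (QuotientGroup.mk' (Λ₀.map (Matrix.GeneralLinearGroup.scalar (Fin n))))) := by
  obtain ⟨e, -⟩ := exists_continuousMulEquiv_map_mk' (unipotentRadicalGL_le_upperUnitriangular c hc) Λ₀
  haveI := secondCountableTopology_unipotentRadicalGL (F := F) c
  exact e.toHomeomorph.symm.secondCountableTopology

/-- `↥N̄_c` is Hausdorff (homeomorphic to `↥U_c`; no closedness of `Λ₀` needed). [folklore] -/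
theorem t2Space_map_unipotentRadicalGL [NeZero n] {r : ℕ} (c : Fin n → Fin r) (hc : Monotone c) (Λ₀ : Subgroup Fˣ)
    [(Λ₀.map (Matrix.GeneralLinearGroup.scalar (Fin n))).Normal] :
    T2Space ↥((unipotentRadicalGL F c).map (QuotientGroup.mk' (Λ₀.map (Matrix.GeneralLinearGroup.scalar (Fin n))))) := by
  haveI : T2Space F := (isLocalField F).toT2Space
  obtain ⟨e, -⟩ := exists_continuousMulEquiv_map_mk' (unipotentRadicalGL_le_upperUnitriangular c hc) Λ₀
  exact e.toHomeomorph.t2Space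

/-- **Every Haar measure on `↥U_c` is RIGHT-invariant** (`U_c` is a union of compact subgroups, hence unimodular). [cite: Folland1995, §2.4 Prop. 2.27, Cor. 2.28] -/
theorem isMulRightInvariant_haar_unipotentRadicalGL {α : Type*} [LinearOrder α] (c : Fin n → α) (hc : Monotone c)
    [MeasurableSpace ↥(unipotentRadicalGL F c)] [BorelSpace ↥(unipotentRadicalGL F c)] (ν : Measure ↥(unipotentRadicalGL F c)) [ν.IsHaarMeasure] :
    ν.IsMulRightInvariant := by
  haveI : T2Space F := (isLocalField F).toT2Space
  haveI := locallyCompactSpace_unipotentRadicalGL (F := F) c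
  haveI := secondCountableTopology_unipotentRadicalGL (F := F) c
  exact Literature.MeasureTheory.Group.isMulRightInvariant_of_forall_mem_isCompact_subgroup ν
    (forall_exists_mem_isCompact_subgroup_of_seq (exists_compactOpen_subgroups_unipotentRadicalGL c hc))

/-- **Every Haar measure on `↥U_c` is INVERSION-invariant.** [cite: Folland1995, §2.4 Prop. 2.27, Cor. 2.28] -/
theorem isInvInvariant_haar_unipotentRadicalGL {α : Type*} [LinearOrder α] (c : Fin n → α) (hc : Monotone c)
    [MeasurableSpace ↥(unipotentRadicalGL F c)] [BorelSpace ↥(unipotentRadicalGL F c)] (ν : Measure ↥(unipotentRadicalGL F c)) [ν.IsHaarMeasure] :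
    ν.IsInvInvariant := by
  haveI : T2Space F := (isLocalField F).toT2Space
  haveI := locallyCompactSpace_unipotentRadicalGL (F := F) c
  haveI := secondCountableTopology_unipotentRadicalGL (F := F) c
  exact Literature.MeasureTheory.Group.isInvInvariant_of_forall_mem_isCompact_subgroup ν
    (forall_exists_mem_isCompact_subgroup_of_seq (exists_compactOpen_subgroups_unipotentRadicalGL c hc))

/-- **Every Haar measure on `↥N̄_c` is RIGHT-invariant.** [cite: Folland1995, §2.4 Prop. 2.27, Cor. 2.28] -/
theorem isMulRightInvariant_haar_map_unipotentRadicalGL [NeZero n] {r : ℕ} (c : Fin n → Fin r) (hc : Monotone c) (Λ₀ : Subgroup Fˣ)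
    [(Λ₀.map (Matrix.GeneralLinearGroup.scalar (Fin n))).Normal]
    [MeasurableSpace ↥((unipotentRadicalGL F c).map (QuotientGroup.mk' (Λ₀.map (Matrix.GeneralLinearGroup.scalar (Fin n)))))]
    [BorelSpace ↥((unipotentRadicalGL F c).map (QuotientGroup.mk' (Λ₀.map (Matrix.GeneralLinearGroup.scalar (Fin n)))))]
    (μ : Measure ↥((unipotentRadicalGL F c).map (QuotientGroup.mk' (Λ₀.map (Matrix.GeneralLinearGroup.scalar (Fin n)))))) [μ.IsHaarMeasure] :
    μ.IsMulRightInvariant := by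
  haveI := locallyCompactSpace_map_unipotentRadicalGL (F := F) c hc Λ₀
  haveI := secondCountableTopology_map_unipotentRadicalGL (F := F) c hc Λ₀
  haveI := t2Space_map_unipotentRadicalGL (F := F) c hc Λ₀
  exact Literature.MeasureTheory.Group.isMulRightInvariant_of_forall_mem_isCompact_subgroup μ
    (forall_exists_mem_isCompact_subgroup_of_seq (exists_compactOpen_subgroups_map_unipotentRadicalGL c hc Λ₀))

/-- **Every Haar measure on `↥N̄_c` is INVERSION-invariant.** [cite: Folland1995, §2.4 Prop. 2.27, Cor. 2.28] -/
theorem isInvInvariant_haar_map_unipotentRadicalGL [NeZero n] {r : ℕ} (c : Fin n → Fin r) (hc : Monotone c) (Λ₀ : Subgroup Fˣ)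
    [(Λ₀.map (Matrix.GeneralLinearGroup.scalar (Fin n))).Normal]
    [MeasurableSpace ↥((unipotentRadicalGL F c).map (QuotientGroup.mk' (Λ₀.map (Matrix.GeneralLinearGroup.scalar (Fin n)))))]
    [BorelSpace ↥((unipotentRadicalGL F c).map (QuotientGroup.mk' (Λ₀.map (Matrix.GeneralLinearGroup.scalar (Fin n)))))]
    (μ : Measure ↥((unipotentRadicalGL F c).map (QuotientGroup.mk' (Λ₀.map (Matrix.GeneralLinearGroup.scalar (Fin n)))))) [μ.IsHaarMeasure] :
    μ.IsInvInvariant := by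
  haveI := locallyCompactSpace_map_unipotentRadicalGL (F := F) c hc Λ₀
  haveI := secondCountableTopology_map_unipotentRadicalGL (F := F) c hc Λ₀
  haveI := t2Space_map_unipotentRadicalGL (F := F) c hc Λ₀
  exact Literature.MeasureTheory.Group.isInvInvariant_of_forall_mem_isCompact_subgroup μ
    (forall_exists_mem_isCompact_subgroup_of_seq (exists_compactOpen_subgroups_map_unipotentRadicalGL c hc Λ₀))

/-! ## §4  Compact support along `U` of functions compactly supported modulo the centre of `GL_n(F)` -/

omit [ValuativeRel F] [TopologicalSpace F] [IsNonarchimedeanLocalField F] in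
/-- The centre of `GL_n(F)` is `F^× · 1 = (⊤ : Subgroup F^×).map (GL.scalar)`. [folklore] -/
theorem center_eq_map_scalar_top : Subgroup.center (GL (Fin n) F) = (⊤ : Subgroup Fˣ).map (Matrix.GeneralLinearGroup.scalar (Fin n)) := by
  rw [Matrix.GeneralLinearGroup.center_eq_range_scalar, MonoidHom.range_eq_map]

/-- **`{u ∈ U | u ∈ C · Z(GL_n(F))}` IS COMPACT for `C` compact** (`U ≤ U_n(F)` closed): ★ FILE 1 `isCompact_preimage_coe_mul_map_scalar` at `Λ₀ = ⊤`.
[cite: HarishChandra1970, Part I §3 p. 9] [cite: Casselman1995, Prop. 1.4.4] -/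
theorem isCompact_preimage_coe_mul_center [NeZero n] {U : Subgroup (GL (Fin n) F)} (hU : U ≤ upperUnitriangular (Fin n) F) (hUc : IsClosed (U : Set (GL (Fin n) F)))
    {C : Set (GL (Fin n) F)} (hC : IsCompact C) :
    IsCompact ((Subtype.val : ↥U → GL (Fin n) F) ⁻¹' (C * (Subgroup.center (GL (Fin n) F) : Set (GL (Fin n) F)))) := by
  rw [center_eq_map_scalar_top]
  exact isCompact_preimage_coe_mul_map_scalar hU hUc ⊤ (by rw [Subgroup.coe_top]; exact isClosed_univ) hC

/-- **COMPACT SUPPORT ALONG `U` OF A FUNCTION COMPACTLY SUPPORTED MODULO THE CENTRE.**  If `supp θ ⊆ C · Z(GL_n(F))` with `C` compact (e.g. a smooth coefficient of a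
SUPERCUSPIDAL representation of `GL_n(F)`), then for all `x, y ∈ GL_n(F)` the function `u ↦ θ(x u y)` on `↥U` (`U ≤ U_n(F)` closed) has compact support: it vanishes off
`{u | u ∈ (x⁻¹ C y⁻¹) · Z}`. [cite: HarishChandra1970, Part I §3 p. 9] [cite: Casselman1995, Prop. 1.4.4, Thm. 5.3.1] -/
theorem hasCompactSupport_comp_translate_of_support_subset_mul_center [NeZero n] {U : Subgroup (GL (Fin n) F)} (hU : U ≤ upperUnitriangular (Fin n) F)
    (hUc : IsClosed (U : Set (GL (Fin n) F))) {E : Type*} [Zero E] {θ : GL (Fin n) F → E} {C : Set (GL (Fin n) F)} (hC : IsCompact C)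
    (hθ : Function.support θ ⊆ C * (Subgroup.center (GL (Fin n) F) : Set (GL (Fin n) F))) (x y : GL (Fin n) F) :
    HasCompactSupport fun u : ↥U => θ (x * (u : GL (Fin n) F) * y) := by
  haveI : T2Space F := (isLocalField F).toT2Space
  have hC' : IsCompact ((fun g : GL (Fin n) F => x⁻¹ * g * y⁻¹) '' C) := hC.image (by fun_prop)
  refine HasCompactSupport.intro (isCompact_preimage_coe_mul_center hU hUc hC') fun u hu => ?_
  by_contra hne
  apply hu
  obtain ⟨g, hg, z, hz, hgz⟩ := Set.mem_mul.1 (hθ (Function.mem_support.2 hne))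
  refine Set.mem_mul.2 ⟨x⁻¹ * g * y⁻¹, Set.mem_image_of_mem _ hg, z, hz, ?_⟩
  have hzy : z * y⁻¹ = y⁻¹ * z := (Subgroup.mem_center_iff.1 hz y⁻¹).symm
  calc x⁻¹ * g * y⁻¹ * z = x⁻¹ * g * (z * y⁻¹) := by rw [hzy]; group
    _ = x⁻¹ * (g * z) * y⁻¹ := by group
    _ = x⁻¹ * (x * (u : GL (Fin n) F) * y) * y⁻¹ := by rw [hgz]
    _ = (u : GL (Fin n) F) := by group

end GLn

end Summit.HodgeConjecture.HodgeConjecture.Cruxes.H413.K2E3GLnUnipotentExhaustion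

end
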